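import Literature.AlgebraicGeometry.Motives.FibrePowerSmoothProjective
import HarnessLib

/-!
# The explicit fibre-power fan `X^{m+1} = X ×ₖ X^{m}` and its comparison with an arbitrary limit fan

Layer `Literature/AlgebraicGeometry/Motives`; sequel to `FibrePowerSmoothProjective` (which proves, by the
same recursion but only existentially, that the point of a limit fan on `m + 1` copies of a smooth projective
`X` is smooth projective). PLUMBING `def`s with bodies and theorems; no named fact (net debt `0`). Written
for the cell `hodge-nonav` (route `SignSymmetricPowers`, crux K2, line `kunneth-tensor-fft`, stub
`stub_kunnethHodgeTensors`): the Künneth decomposition of `Hᴺ(Y)` for a limit fan `Fan.mk Y π` on `m + 2`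
copies of `X` is computed on the EXPLICIT power `X ⊗ X^{m+1}` (the Künneth step of
`HodgeTheory/BettiUniverseKunnethHodge` §4) and transported along the canonical isomorphism `Y ≅ X^{m+2}`
(`isoPowObj`, compatible with the projections).

Construction (Mathlib's `extendFan` / `extendFanIsLimit`, `CategoryTheory/Limits/Constructions/
FiniteProductsOfBinaryProducts`; the cartesian monoidal structure of `SchemeOver k = Over (Spec k)`,
`CartesianMonoidalCategory.tensorProductIsBinaryProduct`): `powFan X 0 = (X, 𝟙)`,
`powFan X (m+1) = extendFan (powFan X m) (BinaryFan.mk fst snd)` with point `powObj X (m+1) = X ⊗ powObj X m`,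
projections `proj 0 = fst`, `proj i.succ = snd ≫ proj i`; `powFanIsLimit`; `isSmoothProjective_powObj`
(Segre, `IsSmoothProjective.tensor_holds`); `isoPowObj π hY : Y ≅ powObj X m` for any limit fan, with
`isoPowObj_hom_proj : (isoPowObj π hY).hom ≫ (powFan X m).proj i = π i`.

References: Hartshorne, *Algebraic Geometry*, II Thm. 3.3 (fibre products exist) and Ex. 5.11, III
Prop. 10.1. [cite: Hartshorne1977, II Thm. 3.3, II Ex. 5.11 and III Prop. 10.1]
-/

noncomputable section

universe u

open CategoryTheory CategoryTheory.Limits MonoidalCategory CartesianMonoidalCategory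

namespace Literature.AlgebraicGeometry.Motives

variable {k : Type u} [Field k]

/-- **The explicit `(m+1)`-fold fibre-power fan** of `X` over `k`: `X` itself with the identity for
`m = 0`, and `extendFan` of the `m`-th power fan by the binary product fan `(fst, snd)` of
`X ⊗ (powFan X m).pt` for `m + 1` (iterated fibre products `X ×ₖ (X ×ₖ ⋯)`).
[cite: Hartshorne1977, II Thm. 3.3] -/
def powFan (X : SchemeOver k) : (m : ℕ) → Fan fun _ : Fin (m + 1) => X
  | 0 => Fan.mk X fun _ => 𝟙 X
  | m + 1 => extendFan (powFan X m) (BinaryFan.mk (fst X (powFan X m).pt) (snd X (powFan X m).pt))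

/-- **The explicit `(m+1)`-fold fibre power** `X^{m+1} := (powFan X m).pt`. [cite: Hartshorne1977, II Thm. 3.3] -/
abbrev powObj (X : SchemeOver k) (m : ℕ) : SchemeOver k := (powFan X m).pt

/-- `X^{1} = X`. [cite: Hartshorne1977, II Thm. 3.3] -/
@[simp]
theorem powObj_zero (X : SchemeOver k) : powObj X 0 = X := rfl

/-- `X^{m+2} = X ⊗ X^{m+1}`. [cite: Hartshorne1977, II Thm. 3.3] -/
@[simp]
theorem powObj_succ (X : SchemeOver k) (m : ℕ) : powObj X (m + 1) = X ⊗ powObj X m := rfl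

/-- The projections of the one-fold power are identities. [cite: Hartshorne1977, II Thm. 3.3] -/
@[simp]
theorem powFan_zero_proj (X : SchemeOver k) (i : Fin 1) : (powFan X 0).proj i = 𝟙 X := rfl

/-- The first projection of `X^{m+2} = X ⊗ X^{m+1}` is `fst`. [cite: Hartshorne1977, II Thm. 3.3] -/
@[simp]
theorem powFan_succ_proj_zero (X : SchemeOver k) (m : ℕ) :
    (powFan X (m + 1)).proj 0 = fst X (powObj X m) := rfl

/-- The later projections of `X^{m+2} = X ⊗ X^{m+1}` are `snd` followed by the projections of `X^{m+1}`.
[cite: Hartshorne1977, II Thm. 3.3] -/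
@[simp]
theorem powFan_succ_proj_succ (X : SchemeOver k) (m : ℕ) (i : Fin (m + 1)) :
    (powFan X (m + 1)).proj i.succ = snd X (powObj X m) ≫ (powFan X m).proj i := rfl

/-- **The explicit fibre-power fan is a limit** (induction: the one-legged identity fan is a limit;
`extendFanIsLimit` with the binary product `tensorProductIsBinaryProduct`). [cite: Hartshorne1977, II Thm. 3.3] -/
def powFanIsLimit (X : SchemeOver k) : (m : ℕ) → IsLimit (powFan X m)
  | 0 => Fan.IsLimit.mk _ (fun s => s.proj 0)
      (fun s j => by
        obtain ⟨j, hj⟩ := j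
        obtain rfl : j = 0 := by omega
        exact Category.comp_id _)
      (fun s f h => by
        have h0 : f ≫ 𝟙 X = s.proj 0 := h 0
        rw [← h0]
        exact (Category.comp_id _).symm)
  | m + 1 => extendFanIsLimit _ (powFanIsLimit X m) (tensorProductIsBinaryProduct X (powObj X m))

/-- **Explicit fibre powers of smooth projective varieties are smooth projective** of dimension
`n * (m + 1)` (Segre; `IsSmoothProjective.tensor_holds`). [cite: Hartshorne1977, III Prop. 10.1 and II Ex. 5.11] -/
theorem isSmoothProjective_powObj {n : ℕ} {X : SchemeOver k} (hX : IsSmoothProjective n X) :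
    (m : ℕ) → IsSmoothProjective (n * (m + 1)) (powObj X m)
  | 0 => by simpa using hX
  | m + 1 => by
    have h : IsSmoothProjective (n + n * (m + 1)) (X ⊗ powObj X m) :=
      IsSmoothProjective.tensor_holds hX (isSmoothProjective_powObj hX m)
    rw [powObj_succ]
    convert h using 2
    ring

/-- **Any limit fan on `m + 1` copies of `X` is canonically isomorphic to the explicit power**:
`Y ≅ X^{m+1}` for `Fan.mk Y π` a limit (uniqueness of limits). [cite: Hartshorne1977, II Thm. 3.3] -/
def isoPowObj {m : ℕ} {X Y : SchemeOver k} (π : Fin (m + 1) → (Y ⟶ X)) (hY : IsLimit (Fan.mk Y π)) :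
    Y ≅ powObj X m :=
  hY.conePointUniqueUpToIso (powFanIsLimit X m)

/-- The canonical isomorphism commutes with the projections: `e.hom ≫ proj i = π i`.
[cite: Hartshorne1977, II Thm. 3.3] -/
@[simp, reassoc]
theorem isoPowObj_hom_proj {m : ℕ} {X Y : SchemeOver k} (π : Fin (m + 1) → (Y ⟶ X))
    (hY : IsLimit (Fan.mk Y π)) (i : Fin (m + 1)) :
    (isoPowObj π hY).hom ≫ (powFan X m).proj i = π i :=
  hY.conePointUniqueUpToIso_hom_comp (powFanIsLimit X m) ⟨i⟩

/-- The inverse isomorphism commutes with the projections: `e.inv ≫ π i = proj i`.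
[cite: Hartshorne1977, II Thm. 3.3] -/
@[simp, reassoc]
theorem isoPowObj_inv_proj {m : ℕ} {X Y : SchemeOver k} (π : Fin (m + 1) → (Y ⟶ X))
    (hY : IsLimit (Fan.mk Y π)) (i : Fin (m + 1)) :
    (isoPowObj π hY).inv ≫ π i = (powFan X m).proj i :=
  hY.conePointUniqueUpToIso_inv_comp (powFanIsLimit X m) ⟨i⟩

/-- For a limit fan on `m + 2` copies: `e.hom ≫ fst = π 0` on `X ⊗ X^{m+1}`. [cite: Hartshorne1977, II Thm. 3.3] -/
@[simp, reassoc]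
theorem isoPowObj_hom_fst {m : ℕ} {X Y : SchemeOver k} (π : Fin (m + 2) → (Y ⟶ X))
    (hY : IsLimit (Fan.mk Y π)) :
    (isoPowObj π hY).hom ≫ fst X (powObj X m) = π 0 :=
  isoPowObj_hom_proj π hY 0

/-- For a limit fan on `m + 2` copies: `e.hom ≫ snd ≫ proj i = π i.succ` on `X ⊗ X^{m+1}`.
[cite: Hartshorne1977, II Thm. 3.3] -/
@[simp, reassoc]
theorem isoPowObj_hom_snd_proj {m : ℕ} {X Y : SchemeOver k} (π : Fin (m + 2) → (Y ⟶ X))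
    (hY : IsLimit (Fan.mk Y π)) (i : Fin (m + 1)) :
    (isoPowObj π hY).hom ≫ snd X (powObj X m) ≫ (powFan X m).proj i = π i.succ :=
  isoPowObj_hom_proj π hY i.succ

end Literature.AlgebraicGeometry.Motives

end
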